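import Summits.RiemannHypothesis.RiemannHypothesis.Theorems.PfPersistenceParityMassLawOdd
import Summits.RiemannHypothesis.RiemannHypothesis.Theorems.PfPersistenceMirrorWindow
import Summits.RiemannHypothesis.RiemannHypothesis.Theorems.PfPersistenceInWindowMirror
import HarnessLib

/-!
# PF persistence — HEAVY DIALS ARE NODAL AT THEIR MIRROR WINDOW: the (floored) nodeless readers reject the heavy-dial
witness family, RH-free and binder-free (pub-rhpf, cand-6 gen 6)

**HONEST FRAMING. This is a long-odds MECHANISM SEARCH ('mechanism/rigidity campaign'); no RH claims.** Every statement
below is RH-free bookkeeping about the cell's observatory records (truncated Weil matrices of weight tables); nothing here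
bears on the truth of RH. Labels: PROVED = kernel-checked here or in the imported tree files.

THE QUESTION. The cell's SHAPE readers — 'the bottom vector is nodeless' (`oneSignedAt`, `floorNodelessAt φ`; odd sector
`oddOneSignedAt`, `floorNodelessOddAt φ`; two-parity handle `floorNodelessEOAt φ`; leaves G1.01 / G1.02 / C4-I6 (eo)) — are
single-window, finitely determined readers, so wall W1 applies to each window: the RH-free negative witnesses behind W1
(and behind the co-convex / fibrewise barriers) are HEAVY prime dials of `ζ` of either sign (`exists_dial_gt_detectablyNegative`,
`exists_dial_lt_detectablyNegative`). Can such a witness INHABIT a nodeless reader (and so close its ∀-window leaf by density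
RH-free)? For inertia readers the answer was NO (`heavyDial_negative_not_mem_of_hyperplanePositive`, C6-MIRROR). This file
gives the SHAPE analogue.

* §1 PARITY CONCENTRATION (PROVED `evenCoord_mass_le`): for `E = Q + t · diag((−1)^i)` and an eigenpair `E u = λ u` with
  `λ ≤ Q_{i₀i₀} − t` at some odd index `i₀` (automatic for a BOTTOM vector) and `Q_{i₀ i₀} ≤ 2t`:
  `(2t − Q_{i₀i₀})² · ‖u|_{even idx}‖² ≤ (Σ Q_{ij}²) · ‖u‖²` — a heavy alternating diagonal empties the raised parity class.
* §2 THE TWO SECTORS OF A DIAL AT ITS MIRROR WINDOW `a = log p` (PROVED; `evenBlock_dial_mirror` 584c3f118826 + the parity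
  dictionary `oddBlock_eq_oddOfEven` 023ff2bd28f7): EVEN block `Q⁺ + (1 − K) w(p) · diag((−1)^n)_{n=0..N}`, ODD block
  `Q⁻ + (K − 1) w(p) · diag((−1)^i)_{i=0..N−1}` (`oddOfEven (diag((−1)^n)) = −diag((−1)^i)`): a DOWN dial (`K < 1`) lowers the
  ODD-indexed cosine modes, an UP dial (`K > 1`) lowers the EVEN-n sine modes — in each case exactly the parity class that
  the PARITY-MASS LAWS (`PfPersistenceParityMassLaw(Odd)`, b774012750c5) forbid a (floor-)one-signed profile to live on
  (anti-periodic under the half-period shift, resp. antisymmetric about `L/4` on `H`).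
* §3 **HEAVY DIALS ARE NODAL AT THEIR MIRROR WINDOW (PROVED, every weight table `w`, every slot `p ≥ 2`, explicit
  threshold):** with `B ≥ 0` any bound `Σ_{ij} Q_{ij}² ≤ B²` on the relevant block of `w` at the window `(log p, N)`:
  `heavyDownDial_not_mem_floorNodelessAt` — `(1 − K) w(p) ≥ 3B`, `> 0`, `N ≥ 1`, `4φ²(2N+1) ≤ 1` ⇒
  `datumOf (dial p K w) ∉ floorNodelessAt φ ⟨log p, N⟩` (NO bottom vector of the even block is `φ`-floor one-signed);
  `heavyUpDial_not_mem_floorNodelessOddAt` — `(K − 1) w(p) ≥ 3B`, `> 0`, `N ≥ 2`, `8φ²N ≤ 1` ⇒ `∉ floorNodelessOddAt φ`;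
  hence `heavyDial_not_mem_floorNodelessEOAt` — `|K − 1| w(p) ≥ 3B`, `≠ 0` ⇒ `∉ floorNodelessEOAt φ` for EITHER SIGN; raw
  (`φ = 0`) corollaries `…_not_mem_oneSignedAt` / `…_not_mem_oddOneSignedAt`; for `ζ` and a prime `p`:
  `zeta_heavyDial_not_mem_floorNodelessEOAt` — every dial with `|K − 1| ≥ 3B / w(p) + 1` is rejected by the two-parity
  floored nodeless reader AT ITS OWN MIRROR WINDOW, every `N ≥ 2`, every admissible floor (`φ = 10⁻²⁰` of record included).
  BINDER-FREE: unlike `DownConeNodal` (binder: `ζ` positive at the window, or `a ≤ 0.59 < log 2`), nothing about `ζ` enters.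

DATA RIDER (rows of record 2026-08-19; script `pub-rhpf-cand-6/queries/g6_paritymass_census.py` → `out/g6_paritymass_census.json`;
harness instrument `cand6-017` PM8eo, pre-registered expects=fails; DATA, not PROVED): writing `m_ev(u)` for the even-indexed `ℓ²`-mass
fraction of the even block's bottom eigenvector and `m_om(v)` for the odd-n (coordinate `i` even) fraction of the odd block's — `ζ`: both `≥ 0.5`
on all 865 rows of record (never below the PROVED nodeless floor `1/8`); the FLIP dials of record `rmf-flip-p{2,3,5}` (`K = −1`, i.e. BELOW
this file's crude threshold `3‖Q‖_F`) ARE parity-concentrated at their mirror windows: `m_ev = 0.0085` (`p = 2`, `a = 0.6966 ≈ log 2`,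
`N = 100`), `2.05·10⁻⁵` (`p = 3`, `a = 1.1 ≈ log 3`), `7.7·10⁻⁴` (`p = 5`, `a = 1.6 ≈ log 5`, `N = 320`) — certified NODAL in the even sector
by the parity-mass law alone — while `m_om → 0.9998 / 1.0` there (the complementary sector concentrates on the odd-n sine modes: no forced
node); `rmf-flip-p{7,11,13}` (mirror windows `a = 1.95 / 2.40 / 2.56` beyond the served range) stay `≥ 0.19`.

READING (soundness clause, not a closure, not a separation claim): the RH-free heavy-dial witness family cannot inhabit
the two-parity nodeless ∀-window reader, so it can never close that leaf by density; a closure must come from SMALL dials,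
whose negativity is DATA. What is NOT decided here: the complementary sectors (even block under an UP dial: bottom vector →
even-indexed cosine modes, an `L/2`-periodic profile with no forced node; odd block under a DOWN dial: odd-n sine modes,
symmetric about `L/4`) — whether those limits are nodeless is a DATA question about `ζ`'s parity-compressed blocks.
-/

set_option linter.dupNamespace false  -- the mandated namespace repeats `RiemannHypothesis`

noncomputable section

open Real Set Matrix Finset

namespace Summit.RiemannHypothesis.RiemannHypothesis.Theorems.PfPersistence

/-! ## §1 Parity concentration of an eigenvector of `Q + t · diag((−1)^i)` -/

/-- The alternating SIGN DIAGONAL `diag((−1)^i)` in dimension `m`. [folklore] -/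
def signDiag (m : ℕ) : Matrix (Fin m) (Fin m) ℝ := Matrix.diagonal fun i : Fin m => (-1 : ℝ) ^ (i : ℕ)

/-- The coordinates of EVEN index of a vector (the others zeroed). [folklore] -/
def evenCoord {m : ℕ} (u : Fin m → ℝ) : Fin m → ℝ := fun i => if Even (i : ℕ) then u i else 0

/-- PROVED: on the even sector `evenIdxPart = evenCoord`. [folklore] -/
theorem evenIdxPart_eq_evenCoord {N : ℕ} (u : Fin (N + 1) → ℝ) : evenIdxPart u = evenCoord u := rfl

/-- PROVED: on the odd sector `oddModePart = evenCoord` (coordinate `j` ↔ mode `j+1`). [folklore] -/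
theorem oddModePart_eq_evenCoord {N : ℕ} (u : Fin N → ℝ) : oddModePart u = evenCoord u := rfl

/-- PROVED: `((Q + t·S) u)_i = (Q u)_i + t (−1)^i u_i`. [folklore] -/
theorem add_smul_signDiag_mulVec {m : ℕ} (Q : Matrix (Fin m) (Fin m) ℝ) (t : ℝ) (u : Fin m → ℝ) (i : Fin m) :
    ((Q + t • signDiag m) *ᵥ u) i = (Q *ᵥ u) i + t * (-1 : ℝ) ^ (i : ℕ) * u i := by
  rw [signDiag, Matrix.add_mulVec, Matrix.smul_mulVec, Pi.add_apply, Pi.smul_apply, Matrix.mulVec_diagonal,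
    smul_eq_mul]
  ring

/-- PROVED: `(Q + t·S)_{ii} = Q_{ii} + t (−1)^i`. [folklore] -/
theorem add_smul_signDiag_apply_self {m : ℕ} (Q : Matrix (Fin m) (Fin m) ℝ) (t : ℝ) (i : Fin m) :
    (Q + t • signDiag m) i i = Q i i + t * (-1 : ℝ) ^ (i : ℕ) := by
  simp [signDiag, Matrix.add_apply, Matrix.smul_apply]

/-- PROVED: `ε₁(M) ≤ M_{ii}` (the Rayleigh quotient of a basis vector). [folklore] -/
theorem bottomRayleigh_le_apply_self {m : ℕ} (M : Matrix (Fin m) (Fin m) ℝ) (i : Fin m) :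
    bottomRayleigh M ≤ M i i := by
  have hv : (Pi.single i (1 : ℝ) : Fin m → ℝ) ≠ 0 := by
    intro h
    have := congr_fun h i
    simp at this
  have h := bottomRayleigh_le_rayleigh M hv
  rw [single_form_single, single_dotProduct, Pi.single_eq_same] at h
  simpa using h

/-- PROVED: an entry is bounded by any bound of the sum of squares: `Σ Q_{ij}² ≤ B²`, `0 ≤ B ⇒ Q_{ij} ≤ B`. [folklore] -/
theorem apply_le_of_sum_sq_le {m : ℕ} {Q : Matrix (Fin m) (Fin m) ℝ} {B : ℝ} (hB0 : 0 ≤ B)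
    (hB : ∑ i, ∑ j, Q i j ^ 2 ≤ B ^ 2) (i j : Fin m) : Q i j ≤ B := by
  have h1 : Q i j ^ 2 ≤ ∑ j', Q i j' ^ 2 :=
    Finset.single_le_sum (f := fun j' => Q i j' ^ 2) (fun _ _ => sq_nonneg _) (Finset.mem_univ j)
  have h2 : ∑ j', Q i j' ^ 2 ≤ ∑ i', ∑ j', Q i' j' ^ 2 :=
    Finset.single_le_sum (f := fun i' => ∑ j', Q i' j' ^ 2) (fun _ _ => Finset.sum_nonneg fun _ _ => sq_nonneg _)
      (Finset.mem_univ i)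
  by_contra h
  have h' : B < Q i j := lt_of_not_ge h
  nlinarith [mul_pos (sub_pos.2 h') (show 0 < Q i j + B by linarith)]

/-- **PROVED — PARITY CONCENTRATION:** for an eigenpair `(Q + t·diag((−1)^i)) u = λ u` with `λ ≤ Q_{i₀i₀} − t` at an ODD
index `i₀` and `Q_{i₀i₀} ≤ 2t`: `(2t − Q_{i₀i₀})² ‖u|_{even idx}‖² ≤ (Σ Q_{ij}²) ‖u‖²`. [folklore] -/
theorem evenCoord_mass_le {m : ℕ} (Q : Matrix (Fin m) (Fin m) ℝ) {t lam : ℝ} {u : Fin m → ℝ}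
    (hE : (Q + t • signDiag m) *ᵥ u = lam • u) {i₀ : Fin m} (hlam : lam ≤ Q i₀ i₀ - t)
    (ht : Q i₀ i₀ ≤ 2 * t) :
    (2 * t - Q i₀ i₀) ^ 2 * (evenCoord u ⬝ᵥ evenCoord u) ≤ (∑ i, ∑ j, Q i j ^ 2) * (u ⬝ᵥ u) := by
  have hpt : ∀ i : Fin m, (2 * t - Q i₀ i₀) ^ 2 * (evenCoord u i * evenCoord u i) ≤ (Q *ᵥ u) i ^ 2 := by
    intro i
    unfold evenCoord
    by_cases hi : Even (i : ℕ)
    · rw [if_pos hi]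
      have h1 := congr_fun hE i
      rw [add_smul_signDiag_mulVec, hi.neg_one_pow, Pi.smul_apply, smul_eq_mul] at h1
      have h2 : (Q *ᵥ u) i = (lam - t) * u i := by linarith
      have h3 : (2 * t - Q i₀ i₀) ^ 2 ≤ (lam - t) ^ 2 := by
        have h4 : (2 * t - Q i₀ i₀) ^ 2 ≤ (t - lam) ^ 2 := pow_le_pow_left₀ (by linarith) (by linarith) 2
        calc (2 * t - Q i₀ i₀) ^ 2 ≤ (t - lam) ^ 2 := h4
          _ = (lam - t) ^ 2 := by ring
      rw [h2, mul_pow]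
      calc (2 * t - Q i₀ i₀) ^ 2 * (u i * u i) ≤ (lam - t) ^ 2 * (u i * u i) :=
            mul_le_mul_of_nonneg_right h3 (mul_self_nonneg _)
        _ = (lam - t) ^ 2 * u i ^ 2 := by ring
    · rw [if_neg hi, mul_zero, mul_zero]
      exact sq_nonneg _
  have hsum : (2 * t - Q i₀ i₀) ^ 2 * (evenCoord u ⬝ᵥ evenCoord u)
      = ∑ i, (2 * t - Q i₀ i₀) ^ 2 * (evenCoord u i * evenCoord u i) := by
    rw [dotProduct, Finset.mul_sum]
  have huu : u ⬝ᵥ u = ∑ j, u j ^ 2 := by simp [dotProduct, sq]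
  rw [hsum]
  calc ∑ i, (2 * t - Q i₀ i₀) ^ 2 * (evenCoord u i * evenCoord u i)
        ≤ ∑ i, (Q *ᵥ u) i ^ 2 := Finset.sum_le_sum fun i _ => hpt i
    _ ≤ ∑ i, (∑ j, Q i j ^ 2) * (u ⬝ᵥ u) := by
        refine Finset.sum_le_sum fun i _ => ?_
        have hcs := Finset.sum_mul_sq_le_sq_mul_sq Finset.univ (fun j => Q i j) u
        rw [huu]
        simpa [Matrix.mulVec, dotProduct] using hcs
    _ = (∑ i, ∑ j, Q i j ^ 2) * (u ⬝ᵥ u) := by rw [Finset.sum_mul]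

/-! ## §2 The two sectors of a dial at its mirror window -/

/-- PROVED (restated with `signDiag`): at the mirror window `a = log p` the EVEN block of the dial `K` at `p` is
`Q⁺(w) + (1 − K) w(p) · diag((−1)^n)`. [folklore] -/
theorem evenBlock_dial_mirror' {p : ℕ} (hp : 2 ≤ p) {win : Window} (hwin : win.a = Real.log p) (K : ℝ) (w : Weights) :
    evenBlock (dial p K w) win = evenBlock w win + ((1 - K) * w p) • signDiag (win.N + 1) := by
  rw [evenBlock_dial_mirror hp hwin K w, signDiag, sub_eq_add_neg, ← neg_smul,
    show -((K - 1) * w p) = (1 - K) * w p by ring]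

/-- PROVED: the parity dictionary sends the sign diagonal of size `N+1` to MINUS the sign diagonal of size `N`
(mode `n = i+1` sits at coordinate `i`). [folklore] -/
theorem oddOfEven_signDiag (N : ℕ) : oddOfEven (signDiag (N + 1)) = -signDiag N := by
  ext i j
  simp only [oddOfEven, deflatedBody, signDiag, Matrix.diagonal_apply, Matrix.neg_apply, Fin.succ_inj,
    (Fin.succ_ne_zero j).symm, if_false, mul_zero, sub_zero, Fin.val_succ]
  by_cases hij : i = j
  · subst hij
    have hi1 : (((i : ℕ) + 1 : ℕ) : ℝ) ≠ 0 := by positivity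
    rw [if_pos rfl, if_pos rfl, div_self hi1, one_mul, pow_succ]
    ring
  · rw [if_neg hij, if_neg hij, mul_zero, neg_zero]

/-- PROVED: `oddOfEven (Q + c · diag((−1)^n)) = oddOfEven Q − c · diag((−1)^i)`. [folklore] -/
theorem oddOfEven_add_smul_signDiag {N : ℕ} (Q : Matrix (Fin (N + 1)) (Fin (N + 1)) ℝ) (c : ℝ) :
    oddOfEven (Q + c • signDiag (N + 1)) = oddOfEven Q - c • signDiag N := by
  have h := oddOfEven_signDiag N
  ext i j
  have hij := congr_fun (congr_fun h i) j
  simp only [oddOfEven, deflatedBody, Matrix.neg_apply] at hij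
  simp only [oddOfEven, deflatedBody, Matrix.add_apply, Matrix.smul_apply, Matrix.sub_apply, smul_eq_mul]
  linear_combination c * hij

/-- **PROVED — THE ODD BLOCK OF A DIAL AT ITS MIRROR WINDOW:** `Q⁻(dial p K w) = Q⁻(w) + (K − 1) w(p) · diag((−1)^i)`:
an UP dial lowers the EVEN-n sine modes (coordinates `i` odd) and raises the odd-n ones. [folklore] -/
theorem oddBlock_dial_mirror {p : ℕ} (hp : 2 ≤ p) {win : Window} (hwin : win.a = Real.log p) (K : ℝ) (w : Weights) :
    oddBlock (dial p K w) win = oddBlock w win + ((K - 1) * w p) • signDiag win.N := by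
  rw [oddBlock_eq_oddOfEven, oddBlock_eq_oddOfEven, evenBlock_dial_mirror' hp hwin, oddOfEven_add_smul_signDiag,
    sub_eq_add_neg, ← neg_smul, show -((1 - K) * w p) = (K - 1) * w p by ring]

/-! ## §3 Heavy dials are nodal at their mirror window -/

/-- **PROVED — A HEAVY DOWN DIAL IS NODAL IN THE EVEN SECTOR AT ITS MIRROR WINDOW:** for every weight table `w`, slot
`p ≥ 2`, window `(log p, N)` with `N ≥ 1`, bound `Σ Q⁺_{ij}² ≤ B²` (`B ≥ 0`) on `w`'s even block there, and floor with
`4φ²(2N+1) ≤ 1`: if `(1 − K) w(p) ≥ 3B` and `> 0` then NO bottom vector of the dial's even block is `φ`-floor one-signed. [folklore] -/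
theorem heavyDownDial_not_mem_floorNodelessAt {p : ℕ} (hp : 2 ≤ p) {win : Window} (hwin : win.a = Real.log p)
    (hN : 1 ≤ win.N) (w : Weights) {K B φ : ℝ} (hB0 : 0 ≤ B)
    (hB : ∑ i, ∑ j, evenBlock w win i j ^ 2 ≤ B ^ 2)
    (ht0 : 0 < (1 - K) * w p) (ht : 3 * B ≤ (1 - K) * w p)
    (hφ : 0 ≤ φ) (hφN : 4 * φ ^ 2 * (2 * win.N + 1) ≤ 1) :
    datumOf (dial p K w) ∉ floorNodelessAt φ win := by
  rintro ⟨u, ⟨hu0, hEu⟩, hfloor⟩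
  set t := (1 - K) * w p with htdef
  set Q := evenBlock w win with hQdef
  have hblock : datumOf (dial p K w) win = Q + t • signDiag (win.N + 1) := evenBlock_dial_mirror' hp hwin K w
  let i₀ : Fin (win.N + 1) := ⟨1, by omega⟩
  have hE : (Q + t • signDiag (win.N + 1)) *ᵥ u = bottomRayleigh (datumOf (dial p K w) win) • u := by
    rw [← hblock]; exact hEu
  have hdiag : datumOf (dial p K w) win i₀ i₀ = Q i₀ i₀ - t := by
    rw [hblock, add_smul_signDiag_apply_self]
    simp [i₀]
    ring
  have hlam : bottomRayleigh (datumOf (dial p K w) win) ≤ Q i₀ i₀ - t :=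
    hdiag ▸ bottomRayleigh_le_apply_self _ i₀
  have hQB : Q i₀ i₀ ≤ B := apply_le_of_sum_sq_le hB0 hB i₀ i₀
  have ht2 : Q i₀ i₀ ≤ 2 * t := by linarith
  have hconc := evenCoord_mass_le Q hE hlam ht2
  have ha : 0 < 2 * win.a := by linarith [win.ha]
  have hmass := parityMass_le_of_floorOneSigned' ha hφ hφN hfloor
  rw [evenIdxPart_eq_evenCoord] at hmass
  have huu : 0 < u ⬝ᵥ u :=
    lt_of_le_of_ne (dotProduct_self_nonneg_real u) fun h => hu0 (dotProduct_self_eq_zero.1 h.symm)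
  have hgap : 4 * B < 2 * t - Q i₀ i₀ := by linarith
  have h1 : (2 * t - Q i₀ i₀) ^ 2 * (u ⬝ᵥ u) ≤ 16 * B ^ 2 * (u ⬝ᵥ u) := by
    calc (2 * t - Q i₀ i₀) ^ 2 * (u ⬝ᵥ u) ≤ (2 * t - Q i₀ i₀) ^ 2 * (16 * (evenCoord u ⬝ᵥ evenCoord u)) :=
          mul_le_mul_of_nonneg_left hmass (sq_nonneg _)
      _ = 16 * ((2 * t - Q i₀ i₀) ^ 2 * (evenCoord u ⬝ᵥ evenCoord u)) := by ring
      _ ≤ 16 * ((∑ i, ∑ j, Q i j ^ 2) * (u ⬝ᵥ u)) := mul_le_mul_of_nonneg_left hconc (by norm_num)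
      _ ≤ 16 * (B ^ 2 * (u ⬝ᵥ u)) :=
          mul_le_mul_of_nonneg_left (mul_le_mul_of_nonneg_right hB huu.le) (by norm_num)
      _ = 16 * B ^ 2 * (u ⬝ᵥ u) := by ring
  have h2 : (2 * t - Q i₀ i₀) ^ 2 ≤ 16 * B ^ 2 := le_of_mul_le_mul_right h1 huu
  nlinarith [mul_pos (sub_pos.2 hgap) (show 0 < 2 * t - Q i₀ i₀ + 4 * B by linarith)]

/-- **PROVED — A HEAVY UP DIAL IS NODAL IN THE ODD SECTOR AT ITS MIRROR WINDOW:** same with the odd block (`N ≥ 2`,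
`Σ Q⁻_{ij}² ≤ B²`, `8φ²N ≤ 1`): if `(K − 1) w(p) ≥ 3B` and `> 0` then NO bottom vector of the dial's odd block is `φ`-floor
one-signed on `H`. [folklore] -/
theorem heavyUpDial_not_mem_floorNodelessOddAt {p : ℕ} (hp : 2 ≤ p) {win : Window} (hwin : win.a = Real.log p)
    (hN : 2 ≤ win.N) (w : Weights) {K B φ : ℝ} (hB0 : 0 ≤ B)
    (hB : ∑ i, ∑ j, oddBlock w win i j ^ 2 ≤ B ^ 2)
    (hc0 : 0 < (K - 1) * w p) (hc : 3 * B ≤ (K - 1) * w p)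
    (hφ : 0 ≤ φ) (hφN : 8 * φ ^ 2 * win.N ≤ 1) :
    datumOf (dial p K w) ∉ floorNodelessOddAt φ win := by
  rintro ⟨u, ⟨hu0, hEu⟩, hfloor⟩
  set c := (K - 1) * w p with hcdef
  set Q := oddBlock w win with hQdef
  have hblock : oddDatum (datumOf (dial p K w)) win = Q + c • signDiag win.N := by
    rw [oddDatum_datumOf, oddBlock_dial_mirror hp hwin]
  let i₀ : Fin win.N := ⟨1, by omega⟩
  have hE : (Q + c • signDiag win.N) *ᵥ u = bottomRayleigh (oddDatum (datumOf (dial p K w)) win) • u := by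
    rw [← hblock]; exact hEu
  have hdiag : oddDatum (datumOf (dial p K w)) win i₀ i₀ = Q i₀ i₀ - c := by
    rw [hblock, add_smul_signDiag_apply_self]
    simp [i₀]
    ring
  have hlam : bottomRayleigh (oddDatum (datumOf (dial p K w)) win) ≤ Q i₀ i₀ - c :=
    hdiag ▸ bottomRayleigh_le_apply_self _ i₀
  have hQB : Q i₀ i₀ ≤ B := apply_le_of_sum_sq_le hB0 hB i₀ i₀
  have hc2 : Q i₀ i₀ ≤ 2 * c := by linarith
  have hconc := evenCoord_mass_le Q hE hlam hc2
  have ha : 0 < 2 * win.a := by linarith [win.ha]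
  have hmass := parityMassOdd_le_of_floorOneSignedOdd' ha hφ hφN hfloor
  rw [oddModePart_eq_evenCoord] at hmass
  have huu : 0 < u ⬝ᵥ u :=
    lt_of_le_of_ne (dotProduct_self_nonneg_real u) fun h => hu0 (dotProduct_self_eq_zero.1 h.symm)
  have hgap : 4 * B < 2 * c - Q i₀ i₀ := by linarith
  have h1 : (2 * c - Q i₀ i₀) ^ 2 * (u ⬝ᵥ u) ≤ 16 * B ^ 2 * (u ⬝ᵥ u) := by
    calc (2 * c - Q i₀ i₀) ^ 2 * (u ⬝ᵥ u) ≤ (2 * c - Q i₀ i₀) ^ 2 * (16 * (evenCoord u ⬝ᵥ evenCoord u)) :=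
          mul_le_mul_of_nonneg_left hmass (sq_nonneg _)
      _ = 16 * ((2 * c - Q i₀ i₀) ^ 2 * (evenCoord u ⬝ᵥ evenCoord u)) := by ring
      _ ≤ 16 * ((∑ i, ∑ j, Q i j ^ 2) * (u ⬝ᵥ u)) := mul_le_mul_of_nonneg_left hconc (by norm_num)
      _ ≤ 16 * (B ^ 2 * (u ⬝ᵥ u)) :=
          mul_le_mul_of_nonneg_left (mul_le_mul_of_nonneg_right hB huu.le) (by norm_num)
      _ = 16 * B ^ 2 * (u ⬝ᵥ u) := by ring
  have h2 : (2 * c - Q i₀ i₀) ^ 2 ≤ 16 * B ^ 2 := le_of_mul_le_mul_right h1 huu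
  nlinarith [mul_pos (sub_pos.2 hgap) (show 0 < 2 * c - Q i₀ i₀ + 4 * B by linarith)]

/-- **PROVED — EVERY HEAVY DIAL, OF EITHER SIGN, IS REJECTED BY THE TWO-PARITY FLOORED NODELESS READER AT ITS MIRROR
WINDOW** (`N ≥ 2`; `B` bounds both blocks of `w` there; `|K − 1| w(p) ≥ 3B`, `≠ 0`; `4φ²(2N+1) ≤ 1`). [folklore] -/
theorem heavyDial_not_mem_floorNodelessEOAt {p : ℕ} (hp : 2 ≤ p) {win : Window} (hwin : win.a = Real.log p)
    (hN : 2 ≤ win.N) (w : Weights) {K B φ : ℝ} (hB0 : 0 ≤ B)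
    (hBe : ∑ i, ∑ j, evenBlock w win i j ^ 2 ≤ B ^ 2) (hBo : ∑ i, ∑ j, oddBlock w win i j ^ 2 ≤ B ^ 2)
    (hK : 3 * B ≤ |(K - 1) * w p|) (hK0 : (K - 1) * w p ≠ 0)
    (hφ : 0 ≤ φ) (hφN : 4 * φ ^ 2 * (2 * win.N + 1) ≤ 1) :
    datumOf (dial p K w) ∉ floorNodelessEOAt φ win := by
  have hφN' : 8 * φ ^ 2 * win.N ≤ 1 := by nlinarith [sq_nonneg φ]
  rintro ⟨heven, hodd⟩
  rcases lt_or_gt_of_ne hK0 with hneg | hpos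
  · have hrw : (1 - K) * w p = -((K - 1) * w p) := by ring
    have ht0 : 0 < (1 - K) * w p := by rw [hrw]; linarith
    have ht : 3 * B ≤ (1 - K) * w p := by rw [abs_of_neg hneg] at hK; rw [hrw]; exact hK
    exact heavyDownDial_not_mem_floorNodelessAt hp hwin (by omega) w hB0 hBe ht0 ht hφ hφN heven
  · have hc : 3 * B ≤ (K - 1) * w p := by rw [abs_of_pos hpos] at hK; exact hK
    exact heavyUpDial_not_mem_floorNodelessOddAt hp hwin hN w hB0 hBo hpos hc hφ hφN' hodd

/-- PROVED (raw reader, `φ = 0`): a heavy DOWN dial is not in `oneSignedAt` at its mirror window. [folklore] -/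
theorem heavyDownDial_not_mem_oneSignedAt {p : ℕ} (hp : 2 ≤ p) {win : Window} (hwin : win.a = Real.log p)
    (hN : 1 ≤ win.N) (w : Weights) {K B : ℝ} (hB0 : 0 ≤ B) (hB : ∑ i, ∑ j, evenBlock w win i j ^ 2 ≤ B ^ 2)
    (ht0 : 0 < (1 - K) * w p) (ht : 3 * B ≤ (1 - K) * w p) :
    datumOf (dial p K w) ∉ oneSignedAt win := by
  rw [← floorNodelessAt_zero]
  exact heavyDownDial_not_mem_floorNodelessAt hp hwin hN w hB0 hB ht0 ht le_rfl (by norm_num)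

/-- PROVED (raw odd reader, `φ = 0`): a heavy UP dial is not in `oddOneSignedAt` at its mirror window. [folklore] -/
theorem heavyUpDial_not_mem_oddOneSignedAt {p : ℕ} (hp : 2 ≤ p) {win : Window} (hwin : win.a = Real.log p)
    (hN : 2 ≤ win.N) (w : Weights) {K B : ℝ} (hB0 : 0 ≤ B) (hB : ∑ i, ∑ j, oddBlock w win i j ^ 2 ≤ B ^ 2)
    (hc0 : 0 < (K - 1) * w p) (hc : 3 * B ≤ (K - 1) * w p) :
    datumOf (dial p K w) ∉ oddOneSignedAt win := by
  rw [← floorNodelessOddAt_zero]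
  exact heavyUpDial_not_mem_floorNodelessOddAt hp hwin hN w hB0 hB hc0 hc le_rfl (by norm_num)

/-- **PROVED — FOR `ζ`: every sufficiently heavy prime dial (`|K − 1| ≥ 3B / w(p) + 1`, either sign) is rejected by the
two-parity floored nodeless reader at its own mirror window `(log p, N)`, every `N ≥ 2`, every admissible floor.**
These dials are the RH-free negative witnesses of wall W1; the statement is RH-free and binder-free. [folklore] -/
theorem zeta_heavyDial_not_mem_floorNodelessEOAt {p : ℕ} (hp : p.Prime) {win : Window} (hwin : win.a = Real.log p)
    (hN : 2 ≤ win.N) {B φ : ℝ} (hB0 : 0 ≤ B)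
    (hBe : ∑ i, ∑ j, evenBlock zetaWeights win i j ^ 2 ≤ B ^ 2)
    (hBo : ∑ i, ∑ j, oddBlock zetaWeights win i j ^ 2 ≤ B ^ 2)
    (hφ : 0 ≤ φ) (hφN : 4 * φ ^ 2 * (2 * win.N + 1) ≤ 1) {K : ℝ} (hK : 3 * B / zetaWeights p + 1 ≤ |K - 1|) :
    datumOf (dial p K zetaWeights) ∉ floorNodelessEOAt φ win := by
  have hw : 0 < zetaWeights p := zetaWeights_pos_of_prime hp
  have hdiv : 0 ≤ 3 * B / zetaWeights p := div_nonneg (by linarith) hw.le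
  have hK1 : 3 * B / zetaWeights p ≤ |K - 1| := by linarith
  have hK' : 3 * B ≤ |(K - 1) * zetaWeights p| := by
    rw [abs_mul, abs_of_pos hw]
    have := (div_le_iff₀ hw).1 hK1
    linarith
  have hK0 : (K - 1) * zetaWeights p ≠ 0 := by
    refine mul_ne_zero (fun h => ?_) hw.ne'
    rw [h, abs_zero] at hK
    linarith
  exact heavyDial_not_mem_floorNodelessEOAt hp.two_le hwin hN zetaWeights hB0 hBe hBo hK' hK0 hφ hφN

end Summit.RiemannHypothesis.RiemannHypothesis.Theorems.PfPersistence
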